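import Summits.ValiantsHypothesis.ValiantsHypothesis.Theorems.LacunarySymmetroidTowerThetaWitnessCore

/-!
# LINE `valuative_door` (crux `WeakLifting`, stmt-ValiantsHypothesis-19561) — the support stub vΘ = `ValThetaWitness`
# of `Cruxes/WeakLifting/Lines/valuative_door.lean` (rev 3), PROVED in its unfolded form: the 2-adic Theta witness

HONEST FRAMING.  Helper (cell `pub-symmetroid`, seat val-sym-lift-p1 g22, 2026-08-29; `--supports 19561 --as helper`).  The line's stub
`stub_valThetaWitness : ValThetaWitness` asks for a real family `Θ_n ∈ ℝ[y_0, …, y_{n-1}]` with `VNP` complexification and exponents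
`d_{n,i}` such that, eventually in `n`, for EVERY non-archimedean absolute value `w` on `ℝ` with `w 2 < 1` the monomial restriction
`Θ_n(X^{d_{n,i}})` has at least `2^{n⌊log₂ n⌋}` dominant exponents (`npEdges w _ + 1 ≥ 2^{n⌊log₂ n⌋}` in the skeleton's currency).

WITNESS (the tree's `thetaWitness_proof`, crux 18052 of route LacunarySymmetroid, with RECIPROCAL constants).  Tavenas' bit polynomial
`h_ν = Σ_{i<2^ν} x^{bits i} z^{bits vExp(ν,i)}` (tree: `TavenasVn.hV`, EXPLICIT in `Literature/…/TavenasVnWitness.lean`) satisfies the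
PARAMETRIC Kronecker identity `h_ν(X^{2^j}; c^{2^l}) = Σ_{i<2^ν} c^{vExp ν i} X^i` for every constant `c` (`aeval_kpc_hV` below — the
tree's `aeval_kpSubst_hV` is the case `c = 2`; this is the identity g21 had asked for as a Literature fact: it needs none, the tree's
`hV` is a definition), and `h_ν` is a projection of `PER_{q(ν)}`, `q` p-bounded, by the tree's `isProjection_boolSum_eval` +
`BCS1997_thm_21_27_holds` + `BCS1997_thm_21_29_holds` + `boolSum_witnessFin` (all kernel).  Put `L = ⌊log₂ n⌋`, `ν = nL`, `β = 2L + 3` and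
substitute DIGITS with reciprocal constants: `x_j ↦ y_{⌊j/β⌋}^{2^{j mod β}}`, `z_l ↦ (1/2)^{2^l}` (`exists_digitSubst_inv`); `Θ_n := h_ν`
so substituted.  `VNP`: verbatim the tree's argument (`isVNPFamily_aeval_of_isPBounded`, `isVNPFamily_map_of_isProjection_perPoly`;
constants are free in Valiant's model).  Along the curve `y_i = X^{2^{βi}}` the restriction is `P_ν = Σ_{i<2^ν} (1/2)^{vExp ν i} X^i`
with `vExp ν i = 2i(2^ν − 1 − i)` STRICTLY CONCAVE; for `w` with `0 < w 2 = q < 1` the coefficient sizes are `q^{−vExp ν i}`, a strictly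
log-CONCAVE profile, so EVERY exponent `E < 2^ν` strictly dominates all others at the radius `r = q^{2M}/q^{4E}` (`M = 2^ν − 1`; the
comparison is `4EE' < 2E² + 2E'²`): `domCount w P_ν = 2^ν` (`card_dominant_thetaRestriction`), i.e. `npEdges + 1 = 2^{n⌊log₂n⌋}` for
every `n ≥ 1`.  (With Tavenas' own constants `2^{2^l}` the profile is log-convex and only two exponents dominate — hence the reciprocals.)

The final theorem `valThetaWitness_unfolded` is the skeleton's `ValThetaWitness` with `npEdges`/`domCount` UNFOLDED binder for binder (the
line file gets `stub_valThetaWitness` by `exact`).  A support stub of LINE (V) (tag [M]+[S], «expected routine») — NOT the crux, closes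
nothing on the ledger by itself, and bears on neither vW / vB / `ValRankOneLaw`, `TropicalB`, `MatrixDescartes` (18050) nor VP ≠ VNP.
[Tavenas 2014 Lemme 3.36 / Cor. 3.37 bookkeeping + an elementary Newton-polygon count]
-/

set_option linter.dupNamespace false
set_option autoImplicit false

noncomputable section

namespace Summit.ValiantsHypothesis.ValiantsHypothesis.Theorems.KPlusLogSqLaw.ValDoor

open MvPolynomial Finset
open scoped BigOperators Classical
open Literature.Computability.AlgebraicComplexity
open Literature.Computability.AlgebraicComplexity.TavenasVn
open Summit.ValiantsHypothesis.ValiantsHypothesis.Theorems.LacunarySymmetroid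
  (isVNPFamily_aeval_of_isPBounded isVNPFamily_map_of_isProjection_perPoly)
open Summit.ValiantsHypothesis.ValiantsHypothesis.Theorems.SymmetroidDescartes (complexity_pow_le)

/-! ### The parametric Kronecker identity for Tavenas' bit polynomial `h_ν` -/

/-- the `x`-monomial `x^{bits e}` of `h_n` under `x_j ↦ X^{2^j}`, `z_l ↦ c^{2^l}` is `X^{ofBits e}`. [cite: Tavenas2014, proof of Prop. 3.17, (3.1)] -/
theorem aeval_kpc_xselV (S : Type) [CommRing S] (c : S) (n : ℕ) (e : Fin n → Bool) :
    aeval (Sum.elim (fun j : Fin (R n) => (Polynomial.X : Polynomial S) ^ 2 ^ (j : ℕ))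
        (fun l : Fin (R n) => Polynomial.C (c ^ 2 ^ (l : ℕ)))) (xselV S n e) =
      (Polynomial.X : Polynomial S) ^ Nat.ofBits e := by
  unfold xselV
  rw [BoolGadgets.ofBits_eq_sum, map_prod]
  have h : ∀ i : Fin n, aeval (Sum.elim (fun j : Fin (R n) => (Polynomial.X : Polynomial S) ^ 2 ^ (j : ℕ))
      (fun l : Fin (R n) => Polynomial.C (c ^ 2 ^ (l : ℕ))))
        (if e i then (X (Sum.inl (xIdx i)) : MvPolynomial (XZ n) S) else 1) =
      (Polynomial.X : Polynomial S) ^ ((e i).toNat * 2 ^ (i : ℕ)) := by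
    intro i
    cases e i
    · simp
    · simp [xIdx]
  simp only [h]
  exact Finset.prod_pow_eq_pow_sum _ _ _

/-- the `z`-monomial `z^{b}` of `h_n` under `x_j ↦ X^{2^j}`, `z_l ↦ c^{2^l}` is the constant `c^{ofBits b}`. [cite: Tavenas2014, proof of Prop. 3.17, (3.1)] -/
theorem aeval_kpc_zselV (S : Type) [CommRing S] (c : S) (n : ℕ) (b : Fin (R n) → Bool) :
    aeval (Sum.elim (fun j : Fin (R n) => (Polynomial.X : Polynomial S) ^ 2 ^ (j : ℕ))
        (fun l : Fin (R n) => Polynomial.C (c ^ 2 ^ (l : ℕ)))) (zselV S n b) =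
      Polynomial.C (c ^ Nat.ofBits b) := by
  unfold zselV
  rw [BoolGadgets.ofBits_eq_sum, map_prod]
  have h : ∀ l : Fin (R n), aeval (Sum.elim (fun j : Fin (R n) => (Polynomial.X : Polynomial S) ^ 2 ^ (j : ℕ))
      (fun l : Fin (R n) => Polynomial.C (c ^ 2 ^ (l : ℕ))))
        (if b l then (X (Sum.inr l) : MvPolynomial (XZ n) S) else 1) =
      Polynomial.C (c ^ ((b l).toNat * 2 ^ (l : ℕ))) := by
    intro l
    cases b l
    · simp
    · simp
  simp only [h]
  rw [← map_prod, Finset.prod_pow_eq_pow_sum]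

/-- **the PARAMETRIC Kronecker identity (display (3.1) with a free constant):** `h_n(X^{2^0}, …, X^{2^{2n+2}}; c^{2^0}, …, c^{2^{2n+2}})
= Σ_{i<2^n} c^{vExp n i} X^i` over every commutative ring `S` and for every `c : S` (the tree's `aeval_kpSubst_hV` is `S = ℚ`, `c = 2`).
[cite: Tavenas2014, Lemme 3.36 / proof of Prop. 3.17, (3.1)] -/
theorem aeval_kpc_hV (S : Type) [CommRing S] (c : S) (n : ℕ) :
    aeval (Sum.elim (fun j : Fin (R n) => (Polynomial.X : Polynomial S) ^ 2 ^ (j : ℕ))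
        (fun l : Fin (R n) => Polynomial.C (c ^ 2 ^ (l : ℕ)))) (hV S n) =
      ∑ i ∈ Finset.range (2 ^ n), Polynomial.C (c ^ vExp n i) * Polynomial.X ^ i := by
  unfold hV
  rw [map_sum]
  have h1 : ∀ e : Fin n → Bool,
      aeval (Sum.elim (fun j : Fin (R n) => (Polynomial.X : Polynomial S) ^ 2 ^ (j : ℕ))
        (fun l : Fin (R n) => Polynomial.C (c ^ 2 ^ (l : ℕ)))) (xselV S n e * zselV S n (vExpBits n (R n) e)) =
      Polynomial.C (c ^ vExp n (Nat.ofBits e)) * Polynomial.X ^ Nat.ofBits e := by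
    intro e
    rw [map_mul, aeval_kpc_xselV, aeval_kpc_zselV, mul_comm]
    congr 3
    rw [vExpBits, Literature.Computability.Complexity.ArithCkt.ofBits_bitsOf,
      Nat.mod_eq_of_lt (vExp_lt_two_pow_R n e)]
  simp only [h1]
  exact BoolGadgets.sum_boolVec_eq_sum_range (fun i => Polynomial.C (c ^ vExp n i) * Polynomial.X ^ i)

/-! ### `h_ν ⊗ ℂ` along a p-bounded index sequence is a `VNP_ℂ` family -/

/-- **`(h_{ν(n)} ⊗ ℂ)_n ∈ VNP_ℂ` for p-bounded `ν`**: `h_ν` is the Boolean sum of the explicit polynomial-size expression `W_ν`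
(`boolSum_witnessFin`), hence a projection of `PER_{N(ν)}` with `N(ν) ≤ 10 (2 E(W_ν) + 2)` (`isProjection_boolSum_eval` from BCS (21.27),
(21.29), both kernel), and base-changed projections of `PER` along a p-bounded reindexing form a `VNP_ℂ` family
(`isVNPFamily_map_of_isProjection_perPoly`). [cite: Tavenas2014, Cor. 3.37; Burgisser2000, §2.1] -/
theorem isVNPFamily_map_hV {ν : ℕ → ℕ} (hν : IsPBounded ν) :
    IsVNPFamily (fun n => MvPolynomial.map (algebraMap ℚ ℂ) (hV ℚ (ν n))) := by
  have hchar : ringChar ℚ ≠ 2 := by rw [ringChar.eq_zero]; norm_num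
  choose N hN hproj using fun n =>
    isProjection_boolSum_eval (BCS1997_thm_21_27_holds ℚ) (BCS1997_thm_21_29_holds ℚ) hchar (witnessFin n)
  have c := fun m : ℕ => IsPBounded.const m
  have hq : IsPBounded N :=
    (IsPBounded.mul_holds (c 10) (IsPBounded.add_holds (IsPBounded.mul_holds (c 2) isPBounded_size_witnessFin)
      (c 2))).mono hN
  have hR : IsPBounded fun n => R (ν n) := IsPBounded.add_holds (IsPBounded.mul_holds (c 2) hν) (c 3)
  refine isVNPFamily_map_of_isProjection_perPoly (σ := fun n => XZ (ν n)) (q := fun n => N (ν n))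
    (IsPBounded.comp_holds hq hν) ?_ (fun n => hV ℚ (ν n)) fun n => ?_
  · refine (IsPBounded.add_holds hR hR).mono fun n => ?_
    rw [Fintype.card_sum, Fintype.card_fin]
  · rw [← boolSum_witnessFin]
    exact hproj (ν n)

/-! ### The digit substitution with reciprocal constants -/

/-- **the digit substitution with RECIPROCAL constants** `x_j ↦ y_{⌊j/β⌋}^{2^{j mod β}}` (`x_j ↦ 0` if `⌊j/β⌋ ≥ n`), `z_l ↦ (1/2)^{2^l}`,
from `m + m` variables into `ℝ[y_0, …, y_{n-1}]`: (i) after base change to `ℂ` every substituted value costs `≤ 2^β` gates and (ii) has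
degree `≤ 2^β` (verbatim the tree's `exists_digitSubst`), and (iii) when `m ≤ β n` the monomial curve `y_i = X^{2^{β i}}` carries it,
AS POLYNOMIALS IN `X`, to the parametric Kronecker point `(X^{2^j}; (1/2)^{2^l})`, because `2^{β ⌊j/β⌋} · 2^{j mod β} = 2^j`.
[cite: Tavenas2014, proof of Prop. 3.17, (3.1); Burgisser2000, §2.1 (constants are free)] -/
theorem exists_digitSubst_inv (n m β : ℕ) (hβ : 0 < β) :
    ∃ g : Fin m ⊕ Fin m → MvPolynomial (Fin n) ℝ,
      (∀ v, complexity (MvPolynomial.map (algebraMap ℝ ℂ) (g v)) ≤ 2 ^ β) ∧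
      (∀ v, (MvPolynomial.map (algebraMap ℝ ℂ) (g v)).totalDegree ≤ 2 ^ β) ∧
      (m ≤ β * n → ∀ v : Fin m ⊕ Fin m,
        aeval (fun i : Fin n => (Polynomial.X : Polynomial ℝ) ^ 2 ^ (β * (i : ℕ))) (g v) =
          Sum.elim (fun j : Fin m => (Polynomial.X : Polynomial ℝ) ^ 2 ^ (j : ℕ))
            (fun l : Fin m => Polynomial.C ((2 : ℝ)⁻¹ ^ 2 ^ (l : ℕ))) v) := by
  have h2β : ∀ j : ℕ, 2 ^ (j % β) ≤ 2 ^ β := fun j =>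
    Nat.pow_le_pow_right (by norm_num) (Nat.mod_lt _ hβ).le
  refine ⟨Sum.elim
      (fun j => if hj : (j : ℕ) / β < n then X ⟨(j : ℕ) / β, hj⟩ ^ 2 ^ ((j : ℕ) % β) else 0)
      (fun l => C ((2 : ℝ)⁻¹ ^ 2 ^ (l : ℕ))), ?_, ?_, ?_⟩
  · -- (i) cost after base change
    rintro (j | l)
    · simp only [Sum.elim_inl]
      split_ifs with hj
      · rw [map_pow, map_X]
        refine (complexity_pow_le _ _).trans ?_
        rw [complexity_X_holds, mul_zero, zero_add]
        exact h2β j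
      · rw [map_zero, ← C_0, complexity_C_holds]
        exact Nat.zero_le _
    · simp only [Sum.elim_inr]
      rw [map_C, complexity_C_holds]
      exact Nat.zero_le _
  · -- (ii) degree after base change
    rintro (j | l)
    · simp only [Sum.elim_inl]
      split_ifs with hj
      · rw [map_pow, map_X]
        refine (totalDegree_pow _ _).trans ?_
        rw [totalDegree_X, mul_one]
        exact h2β j
      · rw [map_zero, totalDegree_zero]
        exact Nat.zero_le _
    · simp only [Sum.elim_inr]
      rw [map_C, totalDegree_C]
      exact Nat.zero_le _
  · -- (iii) the monomial curve goes to the parametric Kronecker point, as polynomials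
    rintro hm (j | l)
    · have hj : (j : ℕ) / β < n :=
        (Nat.div_lt_iff_lt_mul hβ).2 (lt_of_lt_of_le j.2 (hm.trans_eq (Nat.mul_comm _ _)))
      simp only [Sum.elim_inl, dif_pos hj, map_pow, aeval_X]
      rw [← pow_mul, ← pow_add, Nat.div_add_mod (j : ℕ) β]
    · simp only [Sum.elim_inr, aeval_C, Polynomial.algebraMap_eq]

/-! ### The Newton-polygon count of the restriction `P_n = Σ_{i<2^n} (1/2)^{vExp n i} X^i` -/

/-- coefficients of a finite sum of monomials `Σ_{i<N} a_i X^i`. [bookkeeping] -/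
theorem coeff_sum_range_C_mul_X_pow {F : Type*} [Semiring F] (N : ℕ) (a : ℕ → F) (j : ℕ) :
    (∑ i ∈ Finset.range N, Polynomial.C (a i) * Polynomial.X ^ i).coeff j = if j < N then a j else 0 := by
  rw [Polynomial.finsetSum_coeff]
  simp only [Polynomial.coeff_C_mul_X_pow]
  rw [Finset.sum_ite_eq]
  simp only [Finset.mem_range]

/-- support of `Σ_{i<N} a_i X^i` when no `a_i` vanishes. [bookkeeping] -/
theorem mem_support_sum_range_C_mul_X_pow {F : Type*} [Semiring F] (N : ℕ) (a : ℕ → F) (ha : ∀ i, a i ≠ 0) (j : ℕ) :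
    j ∈ (∑ i ∈ Finset.range N, Polynomial.C (a i) * Polynomial.X ^ i).support ↔ j < N := by
  rw [Polynomial.mem_support_iff, coeff_sum_range_C_mul_X_pow]
  constructor
  · intro h
    by_contra hj
    exact h (if_neg hj)
  · intro hj
    rw [if_pos hj]
    exact ha j

/-- **strict concavity of Tavenas' exponent `vExp n i = 2 i (2^n − 1 − i)`**, in the cross-multiplied form used at the radius
`q^{2M}/q^{4E}` (`M = 2^n − 1`): the two sides differ by `2 (E − E')² > 0`. [bookkeeping] -/
theorem vExp_concave_key {n E E' : ℕ} (hE : E < 2 ^ n) (hE' : E' < 2 ^ n) (hne : E' ≠ E) :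
    2 * (2 ^ n - 1) * E + (vExp n E' + 4 * E * E') < 2 * (2 ^ n - 1) * E' + (vExp n E + 4 * E * E) := by
  unfold vExp
  obtain ⟨k, hk⟩ : ∃ k, 2 ^ n - 1 = E + k := Nat.exists_eq_add_of_le (by omega)
  obtain ⟨k', hk'⟩ : ∃ k', 2 ^ n - 1 = E' + k' := Nat.exists_eq_add_of_le (by omega)
  have h1 : 2 ^ n - 1 - E = k := by omega
  have h2 : 2 ^ n - 1 - E' = k' := by omega
  rw [h1, h2, hk]
  rw [hk] at hk'
  have hne' : (E' : ℤ) ≠ E := by exact_mod_cast hne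
  have hsq : (1 : ℤ) ≤ ((E : ℤ) - E') ^ 2 := by
    rcases lt_or_gt_of_ne hne' with h | h <;> nlinarith
  zify at hk' ⊢
  nlinarith [hsq, hk']

/-- **ALL `2^n` EXPONENTS OF `P_n = Σ_{i<2^n} (1/2)^{vExp n i} X^i` ARE DOMINANT** for every absolute value `v` with `0 < v 2 < 1` on any
field: the skeleton's `domCount v P_n` (unfolded) equals `2^n`.  At `q = v 2` the coefficient sizes `q^{−vExp n i}` form a strictly
log-concave profile; the exponent `E` strictly dominates at the radius `q^{2(2^n−1)}/q^{4E}` by `vExp_concave_key`.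
[elementary; Newton polygon with all vertices] -/
theorem card_dominant_thetaRestriction (F : Type) [Field F] (v : AbsoluteValue F ℝ) (h2pos : 0 < v 2) (h2lt : v 2 < 1) (n : ℕ) :
    ((∑ i ∈ Finset.range (2 ^ n), Polynomial.C ((2 : F)⁻¹ ^ vExp n i) * Polynomial.X ^ i).support.filter fun E =>
        ∃ r : ℝ, 0 < r ∧ ∀ E' ∈ (∑ i ∈ Finset.range (2 ^ n), Polynomial.C ((2 : F)⁻¹ ^ vExp n i) * Polynomial.X ^ i).support,
          E' ≠ E →
            v ((∑ i ∈ Finset.range (2 ^ n), Polynomial.C ((2 : F)⁻¹ ^ vExp n i) * Polynomial.X ^ i).coeff E') * r ^ E'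
              < v ((∑ i ∈ Finset.range (2 ^ n), Polynomial.C ((2 : F)⁻¹ ^ vExp n i) * Polynomial.X ^ i).coeff E) * r ^ E).card
      = 2 ^ n := by
  have h2ne : (2 : F) ≠ 0 := by
    intro h
    rw [h, map_zero] at h2pos
    exact lt_irrefl _ h2pos
  have hane : ∀ i : ℕ, ((2 : F)⁻¹ ^ vExp n i) ≠ 0 := fun i => pow_ne_zero _ (inv_ne_zero h2ne)
  set q : ℝ := v 2 with hq
  have key : ∀ a b c : ℕ, (q ^ a)⁻¹ * (q ^ b / q ^ c) = q ^ b / q ^ (a + c) := by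
    intro a b c
    rw [pow_add, div_eq_mul_inv, div_eq_mul_inv, mul_inv]
    ring
  rw [Finset.filter_true_of_mem]
  · -- the support is `range (2^n)`
    have hs : (∑ i ∈ Finset.range (2 ^ n), Polynomial.C ((2 : F)⁻¹ ^ vExp n i) * Polynomial.X ^ i).support =
        Finset.range (2 ^ n) := by
      ext j
      rw [mem_support_sum_range_C_mul_X_pow _ _ hane, Finset.mem_range]
    rw [hs, Finset.card_range]
  · intro E hE
    have hEN := (mem_support_sum_range_C_mul_X_pow _ _ hane E).1 hE
    refine ⟨q ^ (2 * (2 ^ n - 1)) / q ^ (4 * E), by positivity, fun E' hE' hne => ?_⟩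
    have hE'N := (mem_support_sum_range_C_mul_X_pow _ _ hane E').1 hE'
    rw [coeff_sum_range_C_mul_X_pow, coeff_sum_range_C_mul_X_pow, if_pos hEN, if_pos hE'N, map_pow, map_pow, map_inv₀,
      ← hq, div_pow, div_pow, ← pow_mul, ← pow_mul, ← pow_mul, ← pow_mul, inv_pow, inv_pow, key, key,
      div_lt_div_iff₀ (by positivity) (by positivity), ← pow_add, ← pow_add]
    exact pow_right_strictAnti₀ h2pos h2lt (vExp_concave_key hEN hE'N hne)

/-! ### vΘ — the 2-adic Theta witness (the skeleton's `ValThetaWitness`, unfolded) -/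

/-- **`ValThetaWitness` UNFOLDED (LINE `valuative_door`, stub vΘ):** there are a real family `Θ_n ∈ ℝ[y_0, …, y_{n-1}]` with `VNP`
complexification and exponents `d_{n,i}` such that for all `n ≥ 1` and EVERY non-archimedean absolute value `w` on `ℝ` with `w 2 < 1`,
the restriction `Θ_n(X^{d_{n,i}})` has at least `2^{n⌊log₂ n⌋}` dominant exponents (the skeleton's `npEdges w _ + 1`, written out).
Witness: `Θ_n = h_ν ⊗ ℝ` (`ν = n⌊log₂ n⌋`) under the digit substitution with reciprocal constants `(1/2)^{2^l}`, `β = 2⌊log₂ n⌋ + 3`,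
`d_{n,i} = 2^{β i}`; the restriction is `Σ_{i<2^ν} (1/2)^{vExp ν i} X^i` (`aeval_kpc_hV`, after the tree's `TowerDoor.map_hV`), all of whose `2^ν` exponents are dominant
(`card_dominant_thetaRestriction`, `0 < w 2 < 1`), and the complexification is a p-bounded substitution instance of `h_ν ⊗ ℂ ∈ VNP_ℂ`
(`isVNPFamily_map_hV`, `isVNPFamily_aeval_of_isPBounded`).  The `IsNonarchimedean` binder is carried and unused.
[Tavenas2014 Cor. 3.37 bookkeeping; Burgisser2000 §2.1; elementary Newton-polygon count] -/
theorem valThetaWitness_unfolded :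
    ∃ (Θ : ∀ n : ℕ, MvPolynomial (Fin n) ℝ) (d : ∀ n : ℕ, Fin n → ℕ),
      Literature.Computability.AlgebraicComplexity.IsVNPFamily (fun n => MvPolynomial.map (algebraMap ℝ ℂ) (Θ n)) ∧
      ∃ n₀ : ℕ, ∀ n : ℕ, n₀ ≤ n → ∀ w : AbsoluteValue ℝ ℝ, IsNonarchimedean w → w 2 < 1 →
        2 ^ (n * Nat.log 2 n) ≤
          ((MvPolynomial.aeval (fun i => (Polynomial.X : Polynomial ℝ) ^ d n i) (Θ n)).support.filter fun E =>
              ∃ r : ℝ, 0 < r ∧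
                ∀ E' ∈ (MvPolynomial.aeval (fun i => (Polynomial.X : Polynomial ℝ) ^ d n i) (Θ n)).support, E' ≠ E →
                  w ((MvPolynomial.aeval (fun i => (Polynomial.X : Polynomial ℝ) ^ d n i) (Θ n)).coeff E') * r ^ E'
                    < w ((MvPolynomial.aeval (fun i => (Polynomial.X : Polynomial ℝ) ^ d n i) (Θ n)).coeff E) * r ^ E).card
            - 1 + 1 := by
  choose g hgcx hgdeg hgev using fun n : ℕ =>
    exists_digitSubst_inv n (2 * (n * Nat.log 2 n) + 3) (2 * Nat.log 2 n + 3) (Nat.succ_pos _)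
  refine ⟨fun n => aeval (g n) (MvPolynomial.map (algebraMap ℚ ℝ) (hV ℚ (n * Nat.log 2 n))),
    fun n i => 2 ^ ((2 * Nat.log 2 n + 3) * (i : ℕ)), ?_, 1, fun n hn w _hw hw2 => ?_⟩
  · /- VNP: the complexification is the substituted family over `ℂ` (verbatim the tree's `thetaWitness_proof`) -/
    have hβ : ∀ n : ℕ, 2 ^ (2 * Nat.log 2 n + 3) ≤ 8 * (n * n) + 8 := by
      intro n
      rcases Nat.eq_zero_or_pos n with rfl | hn
      · simp
      · have h1 : 2 ^ Nat.log 2 n ≤ n := Nat.pow_log_le_self 2 hn.ne'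
        calc 2 ^ (2 * Nat.log 2 n + 3) = 8 * (2 ^ Nat.log 2 n * 2 ^ Nat.log 2 n) := by ring
          _ ≤ 8 * (n * n) + 8 := by nlinarith [Nat.mul_le_mul h1 h1]
    have hmap : ∀ n : ℕ, MvPolynomial.map (algebraMap ℝ ℂ)
        (aeval (g n) (MvPolynomial.map (algebraMap ℚ ℝ) (hV ℚ (n * Nat.log 2 n)))) =
        aeval (fun v => MvPolynomial.map (algebraMap ℝ ℂ) (g n v))
          (MvPolynomial.map (algebraMap ℚ ℂ) (hV ℚ (n * Nat.log 2 n))) := by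
      intro n
      rw [aeval_eq_bind₁, aeval_eq_bind₁, map_bind₁, MvPolynomial.map_map]
      congr 2
    simp only [hmap]
    have hlog : IsPBounded (Nat.log 2) := IsPBounded.id.mono fun n => Nat.log_le_self 2 n
    have hν : IsPBounded fun n => n * Nat.log 2 n := IsPBounded.mul_holds IsPBounded.id hlog
    have hB : IsPBounded fun n => (n + 2 * (2 * (n * Nat.log 2 n) + 3)) * (8 * (n * n) + 8) :=
      IsPBounded.mul_holds
        (IsPBounded.add_holds IsPBounded.id (IsPBounded.mul_holds (IsPBounded.const 2)
          (IsPBounded.add_holds (IsPBounded.mul_holds (IsPBounded.const 2) hν) (IsPBounded.const 3))))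
        (IsPBounded.add_holds (IsPBounded.mul_holds (IsPBounded.const 8)
          (IsPBounded.mul_holds IsPBounded.id IsPBounded.id)) (IsPBounded.const 8))
    refine isVNPFamily_aeval_of_isPBounded
      (σ := fun n => Fin (2 * (n * Nat.log 2 n) + 3) ⊕ Fin (2 * (n * Nat.log 2 n) + 3))
      (τ := fun n => Fin n) (isVNPFamily_map_hV hν)
      (fun n v => MvPolynomial.map (algebraMap ℝ ℂ) (g n v)) hB
      (fun n => ?_) (fun n => ?_) (fun n v => ?_)
    · -- number of variables of `Θ_n`
      rw [Fintype.card_fin]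
      have : 1 ≤ 8 * (n * n) + 8 := by omega
      calc n ≤ n + 2 * (2 * (n * Nat.log 2 n) + 3) := Nat.le_add_right _ _
        _ = (n + 2 * (2 * (n * Nat.log 2 n) + 3)) * 1 := (mul_one _).symm
        _ ≤ _ := Nat.mul_le_mul_left _ this
    · -- total cost of the substitution
      calc ∑ v, complexity (MvPolynomial.map (algebraMap ℝ ℂ) (g n v))
          ≤ ∑ _v : Fin (2 * (n * Nat.log 2 n) + 3) ⊕ Fin (2 * (n * Nat.log 2 n) + 3),
              2 ^ (2 * Nat.log 2 n + 3) := Finset.sum_le_sum fun v _ => hgcx n v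
        _ = (2 * (2 * (n * Nat.log 2 n) + 3)) * 2 ^ (2 * Nat.log 2 n + 3) := by
          rw [Finset.sum_const, Finset.card_univ, Fintype.card_sum, Fintype.card_fin, smul_eq_mul]
          ring
        _ ≤ (n + 2 * (2 * (n * Nat.log 2 n) + 3)) * (8 * (n * n) + 8) :=
          Nat.mul_le_mul (Nat.le_add_left _ _) (hβ n)
    · -- degrees of the substituted values
      calc (MvPolynomial.map (algebraMap ℝ ℂ) (g n v)).totalDegree ≤ 2 ^ (2 * Nat.log 2 n + 3) :=
            hgdeg n v
        _ ≤ 8 * (n * n) + 8 := hβ n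
        _ = 1 * (8 * (n * n) + 8) := (one_mul _).symm
        _ ≤ (n + 2 * (2 * (n * Nat.log 2 n) + 3)) * (8 * (n * n) + 8) :=
          Nat.mul_le_mul_right _ (by omega)
  · /- dominant exponents: the restriction along `y_i = X^{2^{β i}}` is `P_ν`, `ν = n ⌊log₂ n⌋`, all of whose exponents dominate -/
    have hm : 2 * (n * Nat.log 2 n) + 3 ≤ (2 * Nat.log 2 n + 3) * n := by nlinarith
    have hP : aeval (fun i : Fin n => (Polynomial.X : Polynomial ℝ) ^ 2 ^ ((2 * Nat.log 2 n + 3) * (i : ℕ)))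
        (aeval (g n) (MvPolynomial.map (algebraMap ℚ ℝ) (hV ℚ (n * Nat.log 2 n)))) =
        ∑ i ∈ Finset.range (2 ^ (n * Nat.log 2 n)),
          Polynomial.C ((2 : ℝ)⁻¹ ^ vExp (n * Nat.log 2 n) i) * Polynomial.X ^ i := by
      have hfun : (fun v => aeval (fun i : Fin n => (Polynomial.X : Polynomial ℝ) ^ 2 ^ ((2 * Nat.log 2 n + 3) * (i : ℕ)))
          (g n v)) = Sum.elim (fun j : Fin (2 * (n * Nat.log 2 n) + 3) => (Polynomial.X : Polynomial ℝ) ^ 2 ^ (j : ℕ))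
            (fun l : Fin (2 * (n * Nat.log 2 n) + 3) => Polynomial.C ((2 : ℝ)⁻¹ ^ 2 ^ (l : ℕ))) :=
        funext (hgev n hm)
      rw [Summit.ValiantsHypothesis.ValiantsHypothesis.Theorems.LacunarySymmetroid.TowerDoor.map_hV, comp_aeval_apply, hfun,
        aeval_kpc_hV ℝ (2 : ℝ)⁻¹ (n * Nat.log 2 n)]
    have h2pos : 0 < w 2 := w.pos two_ne_zero
    have hcard := card_dominant_thetaRestriction ℝ w h2pos hw2 (n * Nat.log 2 n)
    have h1 : 1 ≤ 2 ^ (n * Nat.log 2 n) := Nat.one_le_two_pow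
    simp only [hP]
    rw [hcard]
    omega

end Summit.ValiantsHypothesis.ValiantsHypothesis.Theorems.KPlusLogSqLaw.ValDoor

end
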